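import Summits.QuantumFields.YangMills.Theorems.BalabanUVNodesN12ShadowLetterOfBox
import HarnessLib

/-!
# BalabanUVNodes ∕ N12 — THE WINDOW-LOCAL PRODUCER OF THE DIRECT ROAD's GAUGE LETTER (σ)_W, GENERAL `Z`: the tower-axial gauge of the (2.12) minimiser along the rooted forest of record is
# near-flat on every fine bond with both ends in a WINDOW `X` (any set of fine sites) as soon as the datum is normalised on the `k`-shadows within walk-distance `ℓ_k + m′·L^k + L^k`
# OF THE WINDOW — no letter off the window, no condition on the shape of `Ω₁(Z)`

Cell `pub-ymgap` (HUMAN RULINGS D-0062 ∕ D-0149), WIDTH SEAT `pub-ymgap-dag-n12-w6` g7 (node N12 = [B15]; key K1⁹ `stmt-QuantumFields-27364`, `--kind proof --supports … --as helper`;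
count-neutral).  THEOREMS ONLY (0 `def`, 0 `instance`, 0 `sorry`).  The lane owner's (b-direct) LAUNCH (dag-n12-c g20, cell bus 2026-08-28) left ONE item for general `Z`: the window-LOCAL
producer of the window gauge letter (σ)_W displayed by `B15Prop1WindowDirectPackageFromLetters.hWD_of_windowLetters_on` (p658881, binder `hσW`) — today inhabited only by RESTRICTION of the
road of record's (σ)_N (`B15Prop1WindowGaugeLetterOfGaugeLetterLoc`, p661555), whose producers (`…N12GaugeLetterLocExplicitLocal`, `…N12ShadowLetterOfBox`) ask the datum box to cover the
shadows of ALL of `Ω₁(Z)` — uninhabitable when `Ω₁(Z)` is not inside one normalisable box (LOCATED-GEOM v3).  Design note `HOME/pub-ymgap-dag-n12-c/N12-SIGMA-W-PRODUCER-DESIGN.md`.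

WHAT THIS FILE PROVES.  The whole local chain of dag-n12-w3 (p655207 → p656396 → p657430 → p658487 → p660571) is re-run with the TARGET SET generalised from `Ω₁(Z)` to an arbitrary window
`X` of fine sites: the conclusion is asked only on the bonds with both ends in `X`, and correspondingly the ONLY datum-dependent premise — the region-box letter `hBox` — is asked only at the
points of `X`.  Window bonds inside `Ω₁(Z)` get the interior letter (run at `Ω := X ∩ Ω₁(Z)`); window bonds meeting `Ω₁(Z)ᶜ = Γ₀` are PINNED to the datum by (2.12) (p622221
`dist1_gaugeAct_holAtGauge_le_of_not_mem`; their `k`-shadow is in the box by `hBox` at the empty word).  Everything else is read, as there, off the minimiser's graded plaquette bound `hU` (free `ε`: [15] Thm 1 (8) ∕ the class), the lattice geometry of `𝐁_k(Z)` and numerics, BY NAME: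
p635000 `exists_towerForest_rooted_Bj` (the forest: (F2), words, (LEN)∕(DISP), (Cov), (CENTRE)), dag-n12-w6's p640962 §3 `dist1_gaugeAct_holAtGauge_le_graded` (the interior letter PER BOND on
any site set `Ω` — here `Ω := X`), p622221 `toMS_holAtGauge_eq_one` ∕ `isMinimizer_gaugeAct_holAtGauge_atRecord` (`hu`, minimiser-hood), dag-n12-w3's `exists_rootChain_Bj_graded` +
`transporter_of_links_local` (the root transporter of ONE bond reads the members near ITS root only), `iteratedPlaqLetter_of_family_of_plaqSmall` + `exists_segmentPlaqFamily_Bj` +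
`boxPlaqs_src_mem_hullD` (plaquette letters from `hU`), `datumLetter_of_shadows_local` + `shadowLetter_of_box` (stated for any `X` already), `noWrap_of_levelGuard` ∕ `radius_le_of_M₁_ge` ∕
`budget_succ` (numerics).
* §1 ★★ `rootTransporter_atRecord_of_rootLetter` — the graded plaquette-form root-transporter letter of ONE bond `b` inside `Ω₁(Z)`, the datum letter asked only for the members reachable
  from `root b₋` within `m′·L^k` fine steps (dag-n12-w3's `rootTransporter_atRecord_graded_of_plaqSmall_local`, per bond).
* §2 ★★★ `exists_windowGauge_of_plaqSmall` — FREE `ε`: for any window `X` with the box letter at `X`, the tower-axial gauge `σ` of the minimiser has `hu`, `σ • U₀` minimises the same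
  data, and `‖↑((σ•U₀) b) − 1‖ ≤ ((2ℓ_k+1+m′L^k)²∕4)·(ε·η₀²) + m′·(6·(((d+2)L)²∕4)·(2εL²))·Σ_{i<k}Lⁱ + m′·ρn` on every bond with both ends in `X`; ★★★ `exists_windowGauge_of_class` — the
  class corner `ε := εreg` (`hmin.1`).
* The socket shapes — p658881's binder `hσW` per instance and in family form (C1_window on the plaquette window + FEEDS on the window box's level-`k` feeds, under two window rows) — are
  the sequel `…N12WindowGaugeLetterLocalSocket` (one `obtain` each on §2).

HONEST FRAMING.  Composition by name + word bookkeeping; the minimiser ([15] Thm 1 ∕ the lane's (E)), its graded plaquette bound `hU`, the region datum, the window rows and the numerics stay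
HYPOTHESES; per-height ∕ per-instance tolerances (crude: scale-0 Stokes and `θ_k ∼ εL²·L^k`), NOT print's per-level `O(1)`; nothing of Bałaban's asserted beyond the cited tree theorems;
count-neutral; N12 NOT discharged; K1⁹ NOT closed; counts unmoved (typed 28∕28 · discharged 5∕27); one finite 𝕋⁴ programme at fixed `ε = L^{-K}` — R4 closes the conditional rung
`BalabanLadder.UV` only; no summit statement is proved here and NOT the Yang–Mills mass gap (Clay); nothing continuum ∕ ℝ⁴ ∕ OS.

References: [Balaban1985Variational] CMP 102 (1985) 277–309, (2)–(4) p.278, Thm 1 (8) p.279, (16)–(18) p.280; [Balaban1985RegularSpaces] CMP 98 (1985), (1.7) p.77, (1.19) p.79;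
[Balaban1985Averaging] CMP 98 (1985) 17–51, (19)–(20) p.21, Prop. 2 (52)–(53) p.26; [Balaban1988Convergent] CMP 119 (1988) 243–285, (2.2) p.255, (2.11)–(2.13) pp.256–257, (2.16) p.257;
[Balaban1989LargeFieldII] CMP 122 (1989) 355–392, p.357.
-/

noncomputable section

open scoped Matrix.Norms.L2Operator BigOperators

namespace Summit.QuantumFields.YangMills.BalabanUVNodes.N12WindowGaugeLetterLocal

open Literature.MathematicalPhysics.QuantumFieldTheory.Balaban1983to89
open T4Continuum GaugeField B15DeterminingSets BlockAveraging
open T4CubeChartGnomonic (SU2)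
open B16Sect1Backgrounds (toMS)
open T4AxialGaugeSmallField (boxPlaqs)
open B14.Eq213MaximalDomains (side)
open B14.Eq213DetSet (Bj maxDomT)
open B14.Eq216Concrete (inputs)
open B14.Eq22Determines (blockIter)
open B5Eq118OneStroke (iterBlockOf)
open B8Eq17ClassAkV1 (plaqsOf)
open ExpMeanLog (expMeanLogSU deltaSU)
open Literature.MathematicalPhysics.QuantumFieldTheory.BalabanImbrieJaffe1984to88.BIJ85Eq453GaugeField (qsstarGIter0)
open B15Prop1GaugeLetterLocOfForestPackage (length_le_and_netDisp_of_package dist1_gaugeAct_holAtGauge_le_graded)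
open B15Prop1MinimiserTowerAxialGauge (toMS_holAtGauge_eq_one isMinimizer_gaugeAct_holAtGauge_atRecord dist1_gaugeAct_holAtGauge_le_of_not_mem)
open Summit.QuantumFields.YangMills.BalabanUVNodes.N12TowerForestRootsBj (exists_towerForest_rooted_Bj)
open Summit.QuantumFields.YangMills.BalabanUVNodes.N12FlatHndRecordLetters (hcov_Bj)
open Summit.QuantumFields.YangMills.BalabanUVNodes.N12RootTransporterBj (theta_mono_of_nonneg)
open Summit.QuantumFields.YangMills.BalabanUVNodes.N12RootTransporterBjLocal (transporter_of_links_local)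
open Summit.QuantumFields.YangMills.BalabanUVNodes.N12BjRootChainsGraded (exists_rootChain_Bj_graded exists_chain_centre_centre_graded)
open Summit.QuantumFields.YangMills.BalabanUVNodes.N12BjCollarRoots (le_of_iterBlockOf_mem_Bj mem_maxDomT_of_iterBlockOf_mem_Bj)
open Summit.QuantumFields.YangMills.BalabanUVNodes.N12GaugeLetterLocOfClass (boxPlaqs_src_mem_hullD)
open Summit.QuantumFields.YangMills.BalabanUVNodes.N12GaugeLetterLocOfPlaqSmall (iteratedPlaqLetter_of_family_of_plaqSmall)
open Summit.QuantumFields.YangMills.BalabanUVNodes.N12SegmentPlaqFamilyAtRecord (exists_segmentPlaqFamily_Bj)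
open Summit.QuantumFields.YangMills.BalabanUVNodes.N12GaugeLetterLocOfPlaqSmallLocal (datumLetter_of_shadows_local)
open Summit.QuantumFields.YangMills.BalabanUVNodes.N12ShadowLetterOfBox (shadowLetter_of_box)
open Summit.QuantumFields.YangMills.BalabanUVNodes.N12GaugeLetterLocNumerics (noWrap_of_levelGuard radius_le_of_M₁_ge)
open Summit.QuantumFields.YangMills.BalabanUVNodes.N12GaugeLetterLocExplicit (budget_succ)

/-! ## §1 The root-transporter letter of ONE bond, datum letter at its own root -/

/-- ★★ **THE GRADED PLAQUETTE-FORM ROOT-TRANSPORTER LETTER OF ONE BOND, DATUM LETTER AT ITS OWN ROOT.**  dag-n12-w3's `rootTransporter_atRecord_graded_of_plaqSmall_local`, per bond: for ONE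
fine bond `b` inside `Ω₁(Z)`, the root chain `root b₋ ⇝ root b₊` (`exists_rootChain_Bj_graded`: `≤ m′` consecutive member segments of levels `≤ J+1`, `J` the
member level of `b₋`) carries a transporter `𝒰_{U₀}(chain)·g⁻¹` with `dist1 ≤ m′·θ_{min(J+1,k)}` and `dist1 g ≤ m′·δ₁` as soon as (i) the plaquettes of the iterated averages `M^j(U₀)` around the
segments are `a_j`-small with budgets `6·(((d+2)L)²∕4)·a_j + L·θ_j ≤ θ_{j+1}` and (ii) the members `c` with a segment end reachable from `root b₋` within `m′·L^k` fine steps have their (2.12)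
datum `(M˙(Q_k^{s*}W))_i(c)` `δ₁`-near `1` — the datum letter is asked at THIS root only. [cite: Balaban1985Variational, (3)–(4) p.278, (16)–(18) p.280; Balaban1985Averaging, (19)–(20) p.21, Prop. 1 (24) p.22; Balaban1988Convergent, (2.12)–(2.13) pp.256–257, (2.16) p.257] -/
theorem rootTransporter_atRecord_of_rootLetter {F : T4Family} (ν : Node00.Stage7Numerics) (Kt : ℕ) {k : ℕ} (hk1 : 1 ≤ k) (hk : k ≤ (F.P Kt).m + (F.P Kt).K)
    (hM2 : 2 ≤ ν.M₁) (hdiv : side (F.P Kt).L ν.M₁ k ∣ (F.P Kt).sitesPerDir 0) (Z : Set (Site (F.P Kt) 0))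
    (root : Site (F.P Kt) 0 → Site (F.P Kt) 0)
    (hcentre : ∀ (z : Site (F.P Kt) 0) (J : ℕ), iterBlockOf J z ∈ (Bj ν.M₁ Z k : DetSet (F.P Kt)) J →
      ((1 ≤ J ∧ ∃ c ∈ bondsOf ((Bj ν.M₁ Z k : DetSet (F.P Kt)) (J - 1)), (iterBlockOf (J - 1) z = c.src ∨ iterBlockOf (J - 1) z = c.tgt)) ∧
          root z = embIter (J - 1) (iterBlockOf (J - 1) z)) ∨
      (¬ (1 ≤ J ∧ ∃ c ∈ bondsOf ((Bj ν.M₁ Z k : DetSet (F.P Kt)) (J - 1)), (iterBlockOf (J - 1) z = c.src ∨ iterBlockOf (J - 1) z = c.tgt)) ∧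
          root z = embIter J (iterBlockOf J z)))
    {reg : Set (GaugeField (F.P Kt) 0 SU2)} (W : GaugeField (F.P Kt) k SU2) {U₀ : GaugeField (F.P Kt) 0 SU2}
    (hmin : IsMinimizer (Node00.avOfRecord F 2 Kt) reg (Bj ν.M₁ Z k) (avgFamily (Node00.avOfRecord F 2 Kt) (qsstarGIter0 k W)) U₀)
    (a θ : ℕ → ℝ) (hθ0 : 0 ≤ θ 0) (ha0 : ∀ j, 0 ≤ a j)
    (haN : ∀ j < k, (((((F.P Kt).d + 2) * (F.P Kt).L : ℕ) : ℝ) ^ 2 / 4) * a j < deltaSU (Fin 2))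
    (hθ : ∀ j, 6 * ((((((F.P Kt).d + 2) * (F.P Kt).L : ℕ) : ℝ) ^ 2 / 4) * a j) + (F.P Kt).L * θ j ≤ θ (j + 1))
    -- the plaquettes of the iterated averages `M^j(U₀)` in the three blocks around every level-`(j+1)` bond of a member segment are `a_j`-small
    (ha : ∀ i ≤ k, ∀ c ∈ bondsOf ((Bj ν.M₁ Z k : DetSet (F.P Kt)) i), ∀ j < i, ∀ c' : PBond (F.P Kt) (j + 1), c'.dir = c.dir →
      (∃ s < (F.P Kt).L ^ i, embIter (j + 1) c'.src = (fun z : Site (F.P Kt) 0 => z.shift c.dir)^[s] (embIter i c.src)) →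
      ∀ q : Plaq (F.P Kt) j, (blockOf q.src = c'.src.unshift c'.dir ∨ blockOf q.src = c'.src ∨ blockOf q.src = c'.tgt) →
        dist1 (GaugeField.plaqHol (avgFamily (Node00.avOfRecord F 2 Kt) U₀ j) q) < a j)
    {δ₁ : ℝ} (hδ0 : 0 ≤ δ₁)
    (b : PBond (F.P Kt) 0) (hbs : b.src ∈ maxDomT ν.M₁ Z 1) (hbt : b.tgt ∈ maxDomT ν.M₁ Z 1)
    -- the datum letter AT THE ROOT OF `b₋` ONLY: members with a segment end reachable from `root b₋` within `m′·L^k` fine steps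
    (hWj : ∀ i ≤ k, ∀ c ∈ bondsOf ((Bj ν.M₁ Z k : DetSet (F.P Kt)) i),
      (∃ w : List (Letter (F.P Kt).d), w.length ≤ (3 * ((F.P Kt).d * (((F.P Kt).L - 1) / 2)) + 5) * (F.P Kt).L ^ k ∧
        (walkEnd (root b.src) w = embIter i c.src ∨ walkEnd (root b.src) w = embIter i c.tgt)) →
      dist1 (avgFamily (Node00.avOfRecord F 2 Kt) (qsstarGIter0 k W) i c) ≤ δ₁)
    {J : ℕ} (hJ : iterBlockOf J b.src ∈ (Bj ν.M₁ Z k : DetSet (F.P Kt)) J) :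
    ∃ (Ωw : List (Letter (F.P Kt).d)) (g : SU2), walkEnd (root b.src) Ωw = root b.tgt ∧
      Ωw.length ≤ (3 * ((F.P Kt).d * (((F.P Kt).L - 1) / 2)) + 5) * (F.P Kt).L ^ min (J + 1) k ∧
      dist1 (holAt U₀ (walk (root b.src) Ωw) * g⁻¹) ≤ ((3 * ((F.P Kt).d * (((F.P Kt).L - 1) / 2)) + 5 : ℕ) : ℝ) * θ (min (J + 1) k) ∧
      dist1 g ≤ ((3 * ((F.P Kt).d * (((F.P Kt).L - 1) / 2)) + 5 : ℕ) : ℝ) * δ₁ := by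
  have hM : 1 ≤ ν.M₁ := by omega
  -- the member-average letter IS the datum letter, by the constraint (2.12)
  have hδ₁ : ∀ i ≤ k, ∀ c ∈ bondsOf ((Bj ν.M₁ Z k : DetSet (F.P Kt)) i),
      (∃ w : List (Letter (F.P Kt).d), w.length ≤ (3 * ((F.P Kt).d * (((F.P Kt).L - 1) / 2)) + 5) * (F.P Kt).L ^ k ∧
        (walkEnd (root b.src) w = embIter i c.src ∨ walkEnd (root b.src) w = embIter i c.tgt)) →
      dist1 (Averaging.iter (fun i => blockAvg (P := F.P Kt) (j := i) (expMeanLogSU (n := Fin 2))) i U₀ c) ≤ δ₁ := fun i hi c hc hw => by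
    have hagree : avgFamily (Node00.avOfRecord F 2 Kt) U₀ i c = avgFamily (Node00.avOfRecord F 2 Kt) (qsstarGIter0 k W) i c := hmin.2.1 i c hc
    show dist1 (avgFamily (Node00.avOfRecord F 2 Kt) U₀ i c) ≤ δ₁
    rw [hagree]
    exact hWj i hi c hc hw
  have hκ0 : ∀ j, 0 ≤ 6 * ((((((F.P Kt).d + 2) * (F.P Kt).L : ℕ) : ℝ) ^ 2 / 4) * a j) := fun j => by
    have h1 : (0 : ℝ) ≤ (((((F.P Kt).d + 2) * (F.P Kt).L : ℕ) : ℝ) ^ 2 / 4) := by positivity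
    have := mul_nonneg h1 (ha0 j)
    linarith
  have hθmono : ∀ i j, i ≤ j → θ i ≤ θ j := fun i j hij => (theta_mono_of_nonneg _ θ hθ0 hκ0 hθ hij).2
  have hκ : ∀ i ≤ k, ∀ c ∈ bondsOf ((Bj ν.M₁ Z k : DetSet (F.P Kt)) i), ∀ i' < i, ∀ c' : PBond (F.P Kt) (i' + 1), c'.dir = c.dir →
      (∃ t < (F.P Kt).L ^ i, embIter (i' + 1) c'.src = (fun z : Site (F.P Kt) 0 => z.shift c.dir)^[t] (embIter i c.src)) →
      dist1 (corr (expMeanLogSU (n := Fin 2)) (Averaging.iter (fun i => blockAvg (P := F.P Kt) (j := i) (expMeanLogSU (n := Fin 2))) i' U₀) c') ≤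
        6 * ((((((F.P Kt).d + 2) * (F.P Kt).L : ℕ) : ℝ) ^ 2 / 4) * a i') :=
    fun i hi c hc j hj c' hdir hs => BlockAveragingPlaquetteBoundLocal.dist1_corr_le_local (ha0 j) (by omega) c' (ha i hi c hc j hj c' hdir hs) (haN j (lt_of_lt_of_le hj hi))
  -- the graded root chain of `b` and its transporter
  obtain ⟨J', -, hJ'⟩ := hcov_Bj hM hk1 hk hdiv (Z := Z) b.tgt
  obtain ⟨links, hlen, hmem, hgrade, hend, hcons⟩ := exists_rootChain_Bj_graded hk hk1 hM2 hdiv root hcentre b hbs hbt hJ hJ'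
  have hR : links.length * (F.P Kt).L ^ min (J + 1) k ≤ (3 * ((F.P Kt).d * (((F.P Kt).L - 1) / 2)) + 5) * (F.P Kt).L ^ k :=
    Nat.mul_le_mul hlen (Nat.pow_le_pow_right (F.P Kt).L_pos (min_le_right _ _))
  obtain ⟨g, hH, hg, hl⟩ := transporter_of_links_local (expMeanLogSU (n := Fin 2)) U₀ (fun j => 6 * ((((((F.P Kt).d + 2) * (F.P Kt).L : ℕ) : ℝ) ^ 2 / 4) * a j)) θ hθ0 hθ
    (fun i hi => hθmono i _ hi) (Bj ν.M₁ Z k) hκ (root b.src) links hmem (fun l hl => le_min (hgrade l hl).1 (hmem l hl).1) hcons hR hδ₁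
  have hθJ0 : 0 ≤ θ (min (J + 1) k) := hθ0.trans (hθmono 0 _ (Nat.zero_le _))
  have hlenR : (links.length : ℝ) ≤ ((3 * ((F.P Kt).d * (((F.P Kt).L - 1) / 2)) + 5 : ℕ) : ℝ) := by exact_mod_cast hlen
  exact ⟨_, g, hend, hl.trans (Nat.mul_le_mul_right _ hlen), hH.trans (mul_le_mul_of_nonneg_right hlenR hθJ0), hg.trans (mul_le_mul_of_nonneg_right hlenR hδ0)⟩

/-! ## §2 The window gauge: near-flatness on the bonds of a window `X` from the box letter AT `X` -/

/-- ★★★ **THE WINDOW GAUGE OF THE MINIMISER, FREE PLAQUETTE SCALE.**  Objects of one instance: torus `F.P Kt`, numerics `ν`, `1 ≤ k` with a level guard `k + c ≤ m + K` (`4d + m′ + 3 < 2L^c`, no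
wrapping), `M₁ ≥ (4d+m′)L² + 2dL + 12` and `M₁ ≥ ((d+4)L+6)L²` (radii), cover divisibility; a `k`-field `W` (`= ext V_k`) `ρn`-near `1` on a bond set `𝒞` (the region box) generating the (2.12) data;
a minimiser `U₀` in NODE 00's class with the graded plaquette bound `hU` at a FREE `ε > 0` (Prop. 2-small); a WINDOW `X` (any set of fine sites); and the REGION-BOX LETTER AT `X`: `𝒞`
contains the `k`-shadow `⟨B^k y, μ⟩` of every fine point `y` within walk-distance `ℓ_k + m′L^k + L^k` of `X`.  THEN the tower-axial gauge `σ` of the rooted forest of record carries the root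
letter `hu`, `σ • U₀` is a (2.12) minimiser of the same data, and on every fine bond with both ends in `X` (inside `Ω₁(Z)`: interior letter; meeting `Γ₀ = Ω₁(Z)ᶜ`: pinned to the datum)
`‖↑((σ•U₀) b) − 1‖ ≤ ((2ℓ_k+1+m′L^k)²∕4)·(ε·η₀²) + m′·(6·(((d+2)L)²∕4)·(2εL²))·Σ_{i<k}Lⁱ + m′·ρn` (`ℓ_k = Σ_{i≤k}(d(Lⁱ−1)∕2+1)`, `m′ = 3·d·((L−1)∕2) + 5`).  NOTHING is asked off the window.
[cite: Balaban1985Variational, (2)–(4) p.278, Thm 1 (8) p.279, (16)–(18) p.280; Balaban1985RegularSpaces, (1.7) p.77, (1.19) p.79; Balaban1985Averaging, (19)–(20) p.21, Prop. 2 (52)–(53) p.26; Balaban1988Convergent, (2.2) p.255, (2.11)–(2.13) pp.256–257, (2.16) p.257; Balaban1989LargeFieldII, p.357] -/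
theorem exists_windowGauge_of_plaqSmall {F : T4Family} (ν : Node00.Stage7Numerics) (Kt : ℕ) {k : ℕ} (hk0 : 0 < k) (hk : k ≤ (F.P Kt).m + (F.P Kt).K)
    (hdiv : side (F.P Kt).L ν.M₁ k ∣ (F.P Kt).sitesPerDir 0) (Z : Set (Site (F.P Kt) 0))
    -- NUMERICS: level guard (no wrapping) and radii
    {c : ℕ} (hkc : k + c ≤ (F.P Kt).m + (F.P Kt).K) (hc : 4 * (F.P Kt).d + (3 * ((F.P Kt).d * (((F.P Kt).L - 1) / 2)) + 5) + 3 < 2 * (F.P Kt).L ^ c)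
    (hMrad : (4 * (F.P Kt).d + (3 * ((F.P Kt).d * (((F.P Kt).L - 1) / 2)) + 5)) * (F.P Kt).L ^ 2 + 2 * (F.P Kt).d * (F.P Kt).L + 12 ≤ ν.M₁)
    (hM₁ : (((F.P Kt).d + 4) * (F.P Kt).L + 6) * (F.P Kt).L ^ 2 ≤ ν.M₁)
    -- the region-normalised datum and the minimiser
    {ρn : ℝ} (hρn : 0 ≤ ρn)
    (W : GaugeField (F.P Kt) k SU2) (𝒞 : Set (PBond (F.P Kt) k)) (hD : ∀ c ∈ 𝒞, dist1 (W c) ≤ ρn)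
    {U₀ : GaugeField (F.P Kt) 0 SU2}
    (hmin : IsMinimizer (Node00.avOfRecord F 2 Kt) (Node00.regMSCoPOfRecord F 2 ν Kt k (maxDomT ν.M₁ Z)) (Bj ν.M₁ Z k)
      (avgFamily (Node00.avOfRecord F 2 Kt) (qsstarGIter0 k W)) U₀)
    -- the graded plaquette bound for `U₀` on `{Ω_j}` with a FREE `ε > 0` ([15] Thm 1 (8): `ε = B₃·δ̄`; the class: `ε = εreg`), small in Prop. 2's sense at `α₀ := ε·L²`
    {ε : ℝ} (hεpos : 0 < ε)
    (hU : ∀ j ≤ k, PlaqSmallOn (plaqsOf (Node00.topSeq (Node00.suppDomOfRecord F ν Kt (maxDomT ν.M₁ Z)) (maxDomT ν.M₁ Z) j)) (ε * (F.P Kt).eta j ^ 2) U₀)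
    (hα3 : (143 * (((((F.P Kt).d + 4 : ℕ) : ℝ)) ^ 2 / 4) ^ 2) * (ε * (F.P Kt).L ^ 2) ≤ 1 / 3)
    (hα2 : 2 * (ε * (F.P Kt).L ^ 2) ≤ 2 * deltaSU (Fin 2) / ((((F.P Kt).d + 4) * (F.P Kt).L : ℕ) : ℝ) ^ 2)
    (haN : (((((F.P Kt).d + 2) * (F.P Kt).L : ℕ) : ℝ) ^ 2 / 4) * (2 * (ε * (F.P Kt).L ^ 2)) < deltaSU (Fin 2))
    -- THE WINDOW (any set of fine sites) and the REGION-BOX LETTER AT THE WINDOW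
    (X : Set (Site (F.P Kt) 0))
    (hBox : ∀ x ∈ X, ∀ w : List (Letter (F.P Kt).d), w.length ≤ (∑ i ∈ Finset.range (k + 1), ((F.P Kt).d * (((F.P Kt).L ^ i - 1) / 2) + 1)) + (3 * ((F.P Kt).d * (((F.P Kt).L - 1) / 2)) + 5) * (F.P Kt).L ^ k + (F.P Kt).L ^ k →
      ∀ μ : Fin (F.P Kt).d, (⟨blockIter k (walkEnd x w), μ⟩ : PBond (F.P Kt) k) ∈ 𝒞) :
    ∃ σ : GaugeTransf (F.P Kt) 0 SU2,
      (∀ j, j ≤ k → ∀ b ∈ bondsOf (Bj ν.M₁ Z k j), toMS σ j b.src = 1 ∧ toMS σ j b.tgt = 1) ∧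
      IsMinimizer (Node00.avOfRecord F 2 Kt) (Node00.regMSCoPOfRecord F 2 ν Kt k (maxDomT ν.M₁ Z)) (Bj ν.M₁ Z k)
        (avgFamily (Node00.avOfRecord F 2 Kt) (qsstarGIter0 k W)) (gaugeAct σ U₀) ∧
      ∀ b : PBond (F.P Kt) 0, b.src ∈ X → b.tgt ∈ X →
        ‖((gaugeAct σ U₀ b : SU2) : Matrix (Fin 2) (Fin 2) ℂ) - 1‖ ≤
          (((2 * (∑ i ∈ Finset.range (k + 1), ((F.P Kt).d * (((F.P Kt).L ^ i - 1) / 2) + 1)) + 1 +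
              (3 * ((F.P Kt).d * (((F.P Kt).L - 1) / 2)) + 5) * (F.P Kt).L ^ k : ℕ) : ℝ)) ^ 2 / 4 * (ε * (F.P Kt).eta 0 ^ 2) +
            ((3 * ((F.P Kt).d * (((F.P Kt).L - 1) / 2)) + 5 : ℕ) : ℝ) * (6 * ((((((F.P Kt).d + 2) * (F.P Kt).L : ℕ) : ℝ) ^ 2 / 4) * (2 * (ε * (F.P Kt).L ^ 2))) * ∑ i ∈ Finset.range k, ((F.P Kt).L : ℝ) ^ i) +
            ((3 * ((F.P Kt).d * (((F.P Kt).L - 1) / 2)) + 5 : ℕ) : ℝ) * ρn := by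
  classical
  have hk1 : 1 ≤ k := hk0
  have hL2 : 2 ≤ (F.P Kt).L := (F.P Kt).hL.2
  have hM2 : 2 ≤ ν.M₁ := by
    have h4 : 4 ≤ (F.P Kt).L ^ 2 := by nlinarith [hL2]
    have h6 : 6 ≤ ((F.P Kt).d + 4) * (F.P Kt).L + 6 := by omega
    have h24 : 24 ≤ (((F.P Kt).d + 4) * (F.P Kt).L + 6) * (F.P Kt).L ^ 2 := Nat.mul_le_mul h6 h4
    omega
  have hM : 1 ≤ ν.M₁ := by omega
  have hN := noWrap_of_levelGuard (P := F.P Kt) hkc hc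
  have hRad := radius_le_of_M₁_ge (P := F.P Kt) (k := k) hMrad
  -- ### the plaquette letters, all read off `hU`
  have hεP : 0 ≤ ε * (F.P Kt).eta 0 ^ 2 := by unfold Params.eta; positivity
  have hP0 : PlaqSmallOn (plaqsOf (Node00.suppDomOfRecord F ν Kt (maxDomT ν.M₁ Z))) (ε * (F.P Kt).eta 0 ^ 2) U₀ := hU 0 (Nat.zero_le _)
  obtain ⟨Sfam, h1, h2, h3⟩ := exists_segmentPlaqFamily_Bj ν Kt hk hM₁ hdiv Z
  have ha := iteratedPlaqLetter_of_family_of_plaqSmall ν Kt Z hεpos hU hα3 hα2 Sfam h1 h2 h3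
  -- ### the tower budgets `θ`, explicit
  set κ : ℝ := 6 * ((((((F.P Kt).d + 2) * (F.P Kt).L : ℕ) : ℝ) ^ 2 / 4) * (2 * (ε * (F.P Kt).L ^ 2))) with hκ_def
  set θ : ℕ → ℝ := fun j => κ * ∑ i ∈ Finset.range j, ((F.P Kt).L : ℝ) ^ i with hθ_def
  have hθ0 : 0 ≤ θ 0 := by simp [hθ_def]
  have hθ : ∀ j, 6 * ((((((F.P Kt).d + 2) * (F.P Kt).L : ℕ) : ℝ) ^ 2 / 4) * (2 * (ε * (F.P Kt).L ^ 2))) + (F.P Kt).L * θ j ≤ θ (j + 1) :=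
    fun j => (budget_succ (F.P Kt).L κ j).symm.le
  have hκ0 : 0 ≤ κ := by have := hεpos.le; positivity
  have hθmono : ∀ i j, i ≤ j → θ i ≤ θ j := fun i j hij =>
    (theta_mono_of_nonneg (fun _ => κ) θ hθ0 (fun _ => hκ0) hθ hij).2
  have hθk0 : 0 ≤ θ k := hθ0.trans (hθmono 0 k (Nat.zero_le k))
  have hm0 : (0 : ℝ) ≤ ((3 * ((F.P Kt).d * (((F.P Kt).L - 1) / 2)) + 5 : ℕ) : ℝ) := Nat.cast_nonneg _
  -- ### the rooted tower forest of `𝐁_k(Z)` (p635000) and the graded budgets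
  obtain ⟨path, root, -, hF2, -, -, hw, hlevel, hcov, hcentre⟩ :=
    exists_towerForest_rooted_Bj (P := F.P Kt) (M₁ := ν.M₁) (Z := Z) hk hk1 hM2 hdiv
  have hJ : ∀ x : Site (F.P Kt) 0, Classical.choose (hcov x) ≤ k ∧ iterBlockOf (Classical.choose (hcov x)) x ∈ (Bj ν.M₁ Z k : DetSet (F.P Kt)) (Classical.choose (hcov x)) :=
    fun x => Classical.choose_spec (hcov x)
  set ℓs : Site (F.P Kt) 0 → ℕ := fun x => ∑ i ∈ Finset.range (Classical.choose (hcov x) + 1), ((F.P Kt).d * (((F.P Kt).L ^ i - 1) / 2) + 1) with hℓs_def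
  set ℓb : PBond (F.P Kt) 0 → ℕ := fun b => (3 * ((F.P Kt).d * (((F.P Kt).L - 1) / 2)) + 5) * (F.P Kt).L ^ min (Classical.choose (hcov b.src) + 1) k with hℓb_def
  -- the interior part of the window: its points in `Ω₁(Z)`
  set X₁ : Set (Site (F.P Kt) 0) := {x | x ∈ X ∧ x ∈ maxDomT ν.M₁ Z 1} with hX₁_def
  have hℓs : ∀ x ∈ X₁, (path x).length ≤ ℓs x := fun x _ => by
    have hmemR : embIter (Classical.choose (hcov x)) (iterBlockOf (Classical.choose (hcov x)) x) ∈
        {z : Site (F.P Kt) 0 | ∃ j, j ≤ k ∧ ∃ c ∈ bondsOf ((Bj ν.M₁ Z k : DetSet (F.P Kt)) j), (z = embIter j c.src ∨ z = embIter j c.tgt)} :=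
      ⟨_, (hJ x).1, ⟨iterBlockOf (Classical.choose (hcov x)) x, ⟨0, (F.P Kt).hd⟩⟩, Or.inl (hJ x).2, Or.inl rfl⟩
    exact (hlevel x _ (hJ x).1 hmemR).2.1
  have hcapS : ∀ x ∈ X₁, ℓs x ≤ ∑ i ∈ Finset.range (k + 1), ((F.P Kt).d * (((F.P Kt).L ^ i - 1) / 2) + 1) := fun x _ => by
    show (∑ i ∈ Finset.range (Classical.choose (hcov x) + 1), ((F.P Kt).d * (((F.P Kt).L ^ i - 1) / 2) + 1)) ≤ _
    apply Finset.sum_le_sum_of_subset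
    intro i hi
    have hJx := (hJ x).1
    simp only [Finset.mem_range] at hi ⊢
    omega
  have hcapB : ∀ b : PBond (F.P Kt) 0, b.src ∈ X₁ → b.tgt ∈ X₁ →
      ℓb b ≤ (3 * ((F.P Kt).d * (((F.P Kt).L - 1) / 2)) + 5) * (F.P Kt).L ^ k := fun b _ _ =>
    Nat.mul_le_mul_left _ (Nat.pow_le_pow_right (F.P Kt).L_pos (min_le_right _ _))
  have hdisp : ∀ x ∈ X₁, ∀ ν', netDisp ((path x).map fun s => (s.bond.dir, s.fwd)) ν' = ((x ν').val : ℤ) - ((root x ν').val : ℤ) :=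
    fun x _ => (length_le_and_netDisp_of_package ν.M₁ Z k path root hlevel hcov x).2
  -- ### the datum letter AT THE WINDOW: shadows from the box letter, then relative to the roots (prepend the reversed forest path)
  have hGmem := shadowLetter_of_box (𝔹 := (Bj ν.M₁ Z k : DetSet (F.P Kt))) X
    ((∑ i ∈ Finset.range (k + 1), ((F.P Kt).d * (((F.P Kt).L ^ i - 1) / 2) + 1)) + (3 * ((F.P Kt).d * (((F.P Kt).L - 1) / 2)) + 5) * (F.P Kt).L ^ k) 𝒞
    (fun i hi => Nat.pow_le_pow_right (F.P Kt).L_pos hi) hBox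
  have hWjX := datumLetter_of_shadows_local Kt hk (Bj ν.M₁ Z k) W hρn hD X _ hGmem
  have hWjR : ∀ x ∈ X₁, ∀ i ≤ k, ∀ c ∈ bondsOf ((Bj ν.M₁ Z k : DetSet (F.P Kt)) i),
      (∃ w : List (Letter (F.P Kt).d), w.length ≤ (3 * ((F.P Kt).d * (((F.P Kt).L - 1) / 2)) + 5) * (F.P Kt).L ^ k ∧ (walkEnd (root x) w = embIter i c.src ∨ walkEnd (root x) w = embIter i c.tgt)) →
      dist1 (avgFamily (Node00.avOfRecord F 2 Kt) (qsstarGIter0 k W) i c) ≤ ρn := by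
    intro x hx i hi c hc hw'
    obtain ⟨w, hwl, hwe⟩ := hw'
    have hroot : walkEnd x (wordRev ((path x).map fun s => (s.bond.dir, s.fwd))) = root x := by
      have e := walkEnd_walkEnd_wordRev (root x) ((path x).map fun s => (s.bond.dir, s.fwd))
      rwa [(hw x).2.2] at e
    refine hWjX x hx.1 i hi c hc ⟨wordRev ((path x).map fun s => (s.bond.dir, s.fwd)) ++ w, ?_, ?_⟩
    · have hlenW : (wordRev ((path x).map fun s => (s.bond.dir, s.fwd))).length = (path x).length := by simp [wordRev]
      rw [List.length_append, hlenW]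
      exact add_le_add ((hℓs x hx).trans (hcapS x hx)) hwl
    · rw [walkEnd_append, hroot]; exact hwe
  -- ### the root-transporter letter on the bonds of the window (§1, per bond)
  have hT : ∀ b : PBond (F.P Kt) 0, b.src ∈ X₁ → b.tgt ∈ X₁ → root b.src ≠ root b.tgt →
      ∃ (Ωw : List (Letter (F.P Kt).d)) (g : SU2), walkEnd (root b.src) Ωw = root b.tgt ∧ Ωw.length ≤ ℓb b ∧
        dist1 (holAt U₀ (walk (root b.src) Ωw) * g⁻¹) ≤ ((3 * ((F.P Kt).d * (((F.P Kt).L - 1) / 2)) + 5 : ℕ) : ℝ) * θ k ∧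
        dist1 g ≤ ((3 * ((F.P Kt).d * (((F.P Kt).L - 1) / 2)) + 5 : ℕ) : ℝ) * ρn := by
    intro b hbs hbt _
    obtain ⟨Ωw, g, hwe, hl, hH, hg⟩ := rootTransporter_atRecord_of_rootLetter ν Kt hk1 hk hM2 hdiv Z root hcentre W hmin
      (fun _ => 2 * (ε * (F.P Kt).L ^ 2)) θ hθ0 (fun _ => by positivity) (fun j _ => haN) hθ ha hρn b hbs.2 hbt.2 (hWjR b.src hbs) (hJ b.src).2
    exact ⟨Ωw, g, hwe, hl, hH.trans (mul_le_mul_of_nonneg_left (hθmono _ _ (min_le_right _ _)) hm0), hg⟩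
  -- ### the graded boxes lie in the support (level form, then `ℓs`∕`ℓb` form)
  have hℓmono : ∀ {a b : ℕ}, a ≤ b → ∑ i ∈ Finset.range (a + 1), ((F.P Kt).d * (((F.P Kt).L ^ i - 1) / 2) + 1) ≤
      ∑ i ∈ Finset.range (b + 1), ((F.P Kt).d * (((F.P Kt).L ^ i - 1) / 2) + 1) := fun {a b} hab => by
    apply Finset.sum_le_sum_of_subset
    intro i hi
    simp only [Finset.mem_range] at hi ⊢
    omega
  have hSΩ : ∀ b : PBond (F.P Kt) 0, b.src ∈ maxDomT ν.M₁ Z 1 → b.tgt ∈ maxDomT ν.M₁ Z 1 →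
      ∀ J J' : ℕ, iterBlockOf J b.src ∈ (Bj ν.M₁ Z k : DetSet (F.P Kt)) J → iterBlockOf J' b.tgt ∈ (Bj ν.M₁ Z k : DetSet (F.P Kt)) J' →
      (boxPlaqs
          (fun κ => ((b.src κ).val : ℤ) -
            (((2 * max (∑ i ∈ Finset.range (J + 1), ((F.P Kt).d * (((F.P Kt).L ^ i - 1) / 2) + 1))
                  (∑ i ∈ Finset.range (J' + 1), ((F.P Kt).d * (((F.P Kt).L ^ i - 1) / 2) + 1)) + 1 +
                (3 * ((F.P Kt).d * (((F.P Kt).L - 1) / 2)) + 5) * (F.P Kt).L ^ min (J + 1) k) +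
              ∑ i ∈ Finset.range (J + 1), ((F.P Kt).d * (((F.P Kt).L ^ i - 1) / 2) + 1) : ℕ) : ℤ))
          (fun κ => ((b.src κ).val : ℤ) +
            (((2 * max (∑ i ∈ Finset.range (J + 1), ((F.P Kt).d * (((F.P Kt).L ^ i - 1) / 2) + 1))
                  (∑ i ∈ Finset.range (J' + 1), ((F.P Kt).d * (((F.P Kt).L ^ i - 1) / 2) + 1)) + 1 +
                (3 * ((F.P Kt).d * (((F.P Kt).L - 1) / 2)) + 5) * (F.P Kt).L ^ min (J + 1) k) +
              ∑ i ∈ Finset.range (J + 1), ((F.P Kt).d * (((F.P Kt).L ^ i - 1) / 2) + 1) : ℕ) : ℤ) + 2) : Set (Plaq (F.P Kt) 0)) ⊆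
        plaqsOf (Node00.suppDomOfRecord F ν Kt (maxDomT ν.M₁ Z)) := by
    intro b hbs hbt J J' hJb hJ'b p hp
    have hJk : J ≤ k := le_of_iterBlockOf_mem_Bj hJb
    have hJ1 : 1 ≤ J := by
      by_contra h
      have hJ0 : J = 0 := by omega
      subst hJ0
      rw [B14.Eq213DetSet.Bj_zero (by omega)] at hJb
      exact hJb hbs
    obtain ⟨⟨-, hJ'le⟩, -⟩ := exists_chain_centre_centre_graded hM2 hdiv hk b hJ1 hJb hJ'b
    have hxΩ : b.src ∈ maxDomT ν.M₁ Z J := mem_maxDomT_of_iterBlockOf_mem_Bj hM hdiv hk hJ1 hJb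
    set R : ℕ := (2 * max (∑ i ∈ Finset.range (J + 1), ((F.P Kt).d * (((F.P Kt).L ^ i - 1) / 2) + 1))
          (∑ i ∈ Finset.range (J' + 1), ((F.P Kt).d * (((F.P Kt).L ^ i - 1) / 2) + 1)) + 1 +
        (3 * ((F.P Kt).d * (((F.P Kt).L - 1) / 2)) + 5) * (F.P Kt).L ^ min (J + 1) k) +
      ∑ i ∈ Finset.range (J + 1), ((F.P Kt).d * (((F.P Kt).L ^ i - 1) / 2) + 1) with hRdef
    have hmax : max (∑ i ∈ Finset.range (J + 1), ((F.P Kt).d * (((F.P Kt).L ^ i - 1) / 2) + 1))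
        (∑ i ∈ Finset.range (J' + 1), ((F.P Kt).d * (((F.P Kt).L ^ i - 1) / 2) + 1)) ≤
        ∑ i ∈ Finset.range (J + 1 + 1), ((F.P Kt).d * (((F.P Kt).L ^ i - 1) / 2) + 1) :=
      max_le (hℓmono (Nat.le_succ J)) (hℓmono hJ'le)
    have hR : R + 3 ≤ (F.P Kt).L ^ (J - 1) * ν.M₁ := by
      have h := hRad J hJ1 hJk
      omega
    exact Or.inl (boxPlaqs_src_mem_hullD hM hdiv hJ1 hJk hxΩ hR hp)
  have hSΩ' : ∀ b : PBond (F.P Kt) 0, b.src ∈ X₁ → b.tgt ∈ X₁ →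
      (boxPlaqs (fun κ => ((b.src κ).val : ℤ) - (((2 * max (ℓs b.src) (ℓs b.tgt) + 1 + ℓb b) + ℓs b.src : ℕ) : ℤ))
          (fun κ => ((b.src κ).val : ℤ) + (((2 * max (ℓs b.src) (ℓs b.tgt) + 1 + ℓb b) + ℓs b.src : ℕ) : ℤ) + 2) : Set (Plaq (F.P Kt) 0)) ⊆
        plaqsOf (Node00.suppDomOfRecord F ν Kt (maxDomT ν.M₁ Z)) :=
    fun b hbs hbt => hSΩ b hbs.2 hbt.2 _ _ (hJ b.src).2 (hJ b.tgt).2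
  -- ### the tolerance dominates `ρn` (the pinned bonds)
  have hρTOL : ρn ≤
      (((2 * (∑ i ∈ Finset.range (k + 1), ((F.P Kt).d * (((F.P Kt).L ^ i - 1) / 2) + 1)) + 1 +
            (3 * ((F.P Kt).d * (((F.P Kt).L - 1) / 2)) + 5) * (F.P Kt).L ^ k : ℕ) : ℝ)) ^ 2 / 4 * (ε * (F.P Kt).eta 0 ^ 2) +
          ((3 * ((F.P Kt).d * (((F.P Kt).L - 1) / 2)) + 5 : ℕ) : ℝ) * (κ * ∑ i ∈ Finset.range k, ((F.P Kt).L : ℝ) ^ i) +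
          ((3 * ((F.P Kt).d * (((F.P Kt).L - 1) / 2)) + 5 : ℕ) : ℝ) * ρn := by
    have h1 : (0 : ℝ) ≤ (((2 * (∑ i ∈ Finset.range (k + 1), ((F.P Kt).d * (((F.P Kt).L ^ i - 1) / 2) + 1)) + 1 +
            (3 * ((F.P Kt).d * (((F.P Kt).L - 1) / 2)) + 5) * (F.P Kt).L ^ k : ℕ) : ℝ)) ^ 2 / 4 * (ε * (F.P Kt).eta 0 ^ 2) :=
      mul_nonneg (div_nonneg (sq_nonneg _) (by norm_num)) hεP
    have h2 : (0 : ℝ) ≤ ((3 * ((F.P Kt).d * (((F.P Kt).L - 1) / 2)) + 5 : ℕ) : ℝ) * (κ * ∑ i ∈ Finset.range k, ((F.P Kt).L : ℝ) ^ i) := mul_nonneg hm0 hθk0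
    have hm1 : (1 : ℝ) ≤ ((3 * ((F.P Kt).d * (((F.P Kt).L - 1) / 2)) + 5 : ℕ) : ℝ) := Nat.one_le_cast.2 (by omega)
    nlinarith
  -- ### assemble: the tower-axial gauge `σ(x) := 𝒰_{U₀}(path x)`; window bonds inside `Ω₁(Z)` by the interior letter at `X₁`, window bonds meeting `Ω₁(Z)ᶜ` are PINNED to the datum
  refine ⟨fun x => holAt U₀ (path x), toMS_holAtGauge_eq_one path U₀ (Bj ν.M₁ Z k) k hF2,
    isMinimizer_gaugeAct_holAtGauge_atRecord ν Kt hk Z path U₀ hF2 hmin, fun b hbs hbt => ?_⟩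
  by_cases hin : b.src ∈ maxDomT ν.M₁ Z 1 ∧ b.tgt ∈ maxDomT ν.M₁ Z 1
  · exact dist1_gaugeAct_holAtGauge_le_graded U₀ path root (fun x => ⟨(hw x).2.1, (hw x).2.2⟩) X₁ ℓs hℓs hdisp ℓb hcapS hcapB hN hεP hP0 hSΩ'
      (mul_nonneg hm0 hθk0) (mul_nonneg hm0 hρn) hT ⟨hbs, hin.1⟩ ⟨hbt, hin.2⟩
  · have hb' : b.src ∉ maxDomT ν.M₁ Z 1 ∨ b.tgt ∉ maxDomT ν.M₁ Z 1 := not_and_or.mp hin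
    have hsh : (⟨blockIter k b.src, b.dir⟩ : PBond (F.P Kt) k) ∈ 𝒞 := hBox b.src hbs [] (by simp) b.dir
    have h := dist1_gaugeAct_holAtGauge_le_of_not_mem (Node00.avOfRecord F 2 Kt) _ ν.M₁ Z hk0 hk path hF2 W hmin hρn hb' (fun _ => hD _ hsh)
    exact h.trans hρTOL

/-- ★★★ **THE WINDOW GAUGE OF THE MINIMISER, CLASS CORNER** — `exists_windowGauge_of_plaqSmall` at `ε := εreg`: the minimiser's own class of record (`hmin.1`, [15] (2) ∕ [6] (1.7) on
`topSeq Ω₀ Ω j`, `j ≤ k`) supplies the graded plaquette bound.  RESIDUE: CLASS `hmin` · DATUM `W 𝒞 ρn` · WINDOW `X` + BOX LETTER AT `X` · NUMERICS (`εreg` ×4, level guard, two `M₁` floors,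
`hdiv`). [cite: Balaban1985Variational, (2)–(4) p.278, (16)–(18) p.280; Balaban1985RegularSpaces, (1.7) p.77, (1.19) p.79; Balaban1985Averaging, Prop. 2 (52)–(53) p.26; Balaban1988Convergent, (2.12)–(2.13) pp.256–257, (2.16) p.257] -/
theorem exists_windowGauge_of_class {F : T4Family} (ν : Node00.Stage7Numerics) (Kt : ℕ) {k : ℕ} (hk0 : 0 < k) (hk : k ≤ (F.P Kt).m + (F.P Kt).K)
    (hdiv : side (F.P Kt).L ν.M₁ k ∣ (F.P Kt).sitesPerDir 0) (Z : Set (Site (F.P Kt) 0))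
    {c : ℕ} (hkc : k + c ≤ (F.P Kt).m + (F.P Kt).K) (hc : 4 * (F.P Kt).d + (3 * ((F.P Kt).d * (((F.P Kt).L - 1) / 2)) + 5) + 3 < 2 * (F.P Kt).L ^ c)
    (hMrad : (4 * (F.P Kt).d + (3 * ((F.P Kt).d * (((F.P Kt).L - 1) / 2)) + 5)) * (F.P Kt).L ^ 2 + 2 * (F.P Kt).d * (F.P Kt).L + 12 ≤ ν.M₁)
    (hM₁ : (((F.P Kt).d + 4) * (F.P Kt).L + 6) * (F.P Kt).L ^ 2 ≤ ν.M₁)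
    {ρn : ℝ} (hρn : 0 ≤ ρn)
    (W : GaugeField (F.P Kt) k SU2) (𝒞 : Set (PBond (F.P Kt) k)) (hD : ∀ c ∈ 𝒞, dist1 (W c) ≤ ρn)
    {U₀ : GaugeField (F.P Kt) 0 SU2}
    (hmin : IsMinimizer (Node00.avOfRecord F 2 Kt) (Node00.regMSCoPOfRecord F 2 ν Kt k (maxDomT ν.M₁ Z)) (Bj ν.M₁ Z k)
      (avgFamily (Node00.avOfRecord F 2 Kt) (qsstarGIter0 k W)) U₀)
    -- the class threshold `εreg`: positive and small
    (hεpos : 0 < ν.εreg)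
    (hα3 : (143 * (((((F.P Kt).d + 4 : ℕ) : ℝ)) ^ 2 / 4) ^ 2) * (ν.εreg * (F.P Kt).L ^ 2) ≤ 1 / 3)
    (hα2 : 2 * (ν.εreg * (F.P Kt).L ^ 2) ≤ 2 * deltaSU (Fin 2) / ((((F.P Kt).d + 4) * (F.P Kt).L : ℕ) : ℝ) ^ 2)
    (haN : (((((F.P Kt).d + 2) * (F.P Kt).L : ℕ) : ℝ) ^ 2 / 4) * (2 * (ν.εreg * (F.P Kt).L ^ 2)) < deltaSU (Fin 2))
    (X : Set (Site (F.P Kt) 0))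
    (hBox : ∀ x ∈ X, ∀ w : List (Letter (F.P Kt).d), w.length ≤ (∑ i ∈ Finset.range (k + 1), ((F.P Kt).d * (((F.P Kt).L ^ i - 1) / 2) + 1)) + (3 * ((F.P Kt).d * (((F.P Kt).L - 1) / 2)) + 5) * (F.P Kt).L ^ k + (F.P Kt).L ^ k →
      ∀ μ : Fin (F.P Kt).d, (⟨blockIter k (walkEnd x w), μ⟩ : PBond (F.P Kt) k) ∈ 𝒞) :
    ∃ σ : GaugeTransf (F.P Kt) 0 SU2,
      (∀ j, j ≤ k → ∀ b ∈ bondsOf (Bj ν.M₁ Z k j), toMS σ j b.src = 1 ∧ toMS σ j b.tgt = 1) ∧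
      IsMinimizer (Node00.avOfRecord F 2 Kt) (Node00.regMSCoPOfRecord F 2 ν Kt k (maxDomT ν.M₁ Z)) (Bj ν.M₁ Z k)
        (avgFamily (Node00.avOfRecord F 2 Kt) (qsstarGIter0 k W)) (gaugeAct σ U₀) ∧
      ∀ b : PBond (F.P Kt) 0, b.src ∈ X → b.tgt ∈ X →
        ‖((gaugeAct σ U₀ b : SU2) : Matrix (Fin 2) (Fin 2) ℂ) - 1‖ ≤
          (((2 * (∑ i ∈ Finset.range (k + 1), ((F.P Kt).d * (((F.P Kt).L ^ i - 1) / 2) + 1)) + 1 +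
              (3 * ((F.P Kt).d * (((F.P Kt).L - 1) / 2)) + 5) * (F.P Kt).L ^ k : ℕ) : ℝ)) ^ 2 / 4 * (ν.εreg * (F.P Kt).eta 0 ^ 2) +
            ((3 * ((F.P Kt).d * (((F.P Kt).L - 1) / 2)) + 5 : ℕ) : ℝ) * (6 * ((((((F.P Kt).d + 2) * (F.P Kt).L : ℕ) : ℝ) ^ 2 / 4) * (2 * (ν.εreg * (F.P Kt).L ^ 2))) * ∑ i ∈ Finset.range k, ((F.P Kt).L : ℝ) ^ i) +
            ((3 * ((F.P Kt).d * (((F.P Kt).L - 1) / 2)) + 5 : ℕ) : ℝ) * ρn :=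
  exists_windowGauge_of_plaqSmall ν Kt hk0 hk hdiv Z hkc hc hMrad hM₁ hρn W 𝒞 hD hmin hεpos
    (fun j hj => ((Node00.mem_regMSCoPOfRecord_iff F 2 ν Kt k (maxDomT ν.M₁ Z) U₀).1 hmin.1).1 j hj) hα3 hα2 haN X hBox


end Summit.QuantumFields.YangMills.BalabanUVNodes.N12WindowGaugeLetterLocal

end
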